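import Literature.MathematicalPhysics.QuantumLattice.HubbardNNNHoppingPairCorrelatorCertificate
import HarnessLib

/-!
# `t–t'` Hubbard model: a POINT-GROUP-REDUCED window certificate bounds the `D₄`-orbit-averaged
# pair correlator `|S|⁻¹ Σ_{γ∈S} L⁻² Σ_x Re ⟨ψ, Δ_x† Δ_{x+γr} ψ⟩` of EVERY sector ground state

Family `hubbard` (topic `MathematicalPhysics/QuantumLattice`). Companion of
`HubbardNNNHoppingPairCorrelatorCertificate` (translations only, `S = {1}`). There the symmetry
reductions of the certificate had to be restricted to lattice translations, because the point-group
defects `U_γ Y U_γᴴ − Y` do not average to zero in the translation-averaged state of a ground-state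
VECTOR lying in a degenerate multiplet. Here the observation is that they need not: for a pair form
factor `g` of definite parity under `S ⊆ D₄` (`g(γe) = χ(γ) g(e)`, `χ(γ)² = 1`; the `d_{x²−y²}` factor has
`χ = χ_{B₁g}`, Scalapino 1995 §2 eq. (2.3)) the space-group average of the objective is itself a
physical quantity,

  `Σ_{(w,γ) ∈ 𝕋_L × S} V_{(w,γ)} (Δ_0† Δ_r) V_{(w,γ)}ᴴ = Σ_{γ ∈ S} Σ_x Δ_x† Δ_{x + γr}`
  (`sum_spaceGroupUnitary_conj_localPair_corr`; `U_γ Δ^g_x U_γᴴ = χ(γ) Δ^g_{γx}`, `|χ|² = 1`),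

so `⟨ψ, (Σ_{γ∈S} Σ_x Δ_x† Δ_{x+γr}) ψ⟩ = L² |S| · ω̄_ψ(Δ_0† Δ_r)` with `ω̄_ψ = orbitState (spaceGroupUnitary S) ψ`
the space-group-averaged vector state (`star_dotProduct_sum_pairCorrSum_mulVec_eq`). Consequently
(`re_sum_pairCorrSum_groundState_ge_of_window_certificate_d4_TT'`, and `…_dWave`): ONE window
certificate for the objective `windowPairCorrObs ({0} ∪ unitSteps) g r` using translation AND point-group
(`γₗ ∈ S`) reductions and the energy constraint `κ (u·1 − Γ E^{tt'}_Φ)`, `κ ≥ 0`, gives for EVERY `L ≥ 3`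
(window fits), every `n ≤ |𝕋_L|` with `groundEnergy (hubbardTorusTT' L t t' U) (2n) ≤ u L²` and EVERY unit
ground state `ψ` of the sector `(2n, S^z = 0)` — every vector of a degenerate ground level —
`c − Σₖ ‖aₖ‖ + (Σ_σ μ_σ)(n/L² − ν) ≤ (L² |S|)⁻¹ Σ_{γ∈S} Re ⟨ψ, (Σ_x Δ_x† Δ_{x + γ r̄}) ψ⟩`,
i.e. a bound, uniform in `L`, on the AVERAGE over the orbit `S·r` of the translation-averaged pair
correlator (for `r = (2,0)`, `S = D₄`: the mean of `P̄(±2,0)`, `P̄(0,±2)`). The symmetric certificate is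
the cheaper one (block-diagonalisation by `S`), and for the order/no-order dichotomy the orbit average is
the natural quantity. HONEST FRAMING: soundness edge of a finite-size / thermodynamic-limit correlator
table (ladder R1–R4 with certified numbers); no claim on the Hubbard ground state itself.

## References
* D. J. Scalapino, Phys. Rep. 250 (1995) 329, §2 eq. (2.2)–(2.3) (pair fields, `B₁g` character). [cite: Scalapino1995, §2]
* J. Wang et al., PRX 14 (2024) 031006, §III (symmetry-reduced, energy-constrained RDM bootstrap). [cite: WangEtAl2024, §III]
* X. Han, arXiv:2006.06002 (2020), §2–3 (space-group-invariant relaxation). [cite: Han2020Bootstrap, §3]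
-/

noncomputable section

namespace Literature.MathematicalPhysics.QuantumLattice

open Matrix Finset HubbardWave0 Literature.Probability.LatticeModels
open Literature.MathematicalPhysics.QuantumManyBody.StateRelaxation
open scoped ComplexOrder BigOperators

section Covariance

/-- `γ` fixes the origin of the torus (`d4Site γ` is additive). [folklore] -/
private theorem d4Site_zero {L : ℕ} (γ : DihedralGroup 4) : d4Site γ (0 : TorusSite 2 L) = 0 :=
  (AddMonoidHom.mk' (d4Site γ) (d4Site_add γ)).map_zero

variable {L : ℕ} [NeZero L]

/-- (Local to this section, as in `HubbardNNNHoppingPairCorrelatorCertificate`.) [folklore] -/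
local instance (priority := high) instDecidableEqFermionTorusPairD4 : DecidableEq (FermionTorus 2 L) :=
  LinearOrder.toDecidableEq

/-- **`D₄` covariance of a pair of definite parity**: if `g (γ e) = χ g(e)` with `χ² = 1` then
`U_γ Δ^g_x U_γᴴ = χ Δ^g_{γx}`. Scalapino 1995 §2 eq. (2.2)–(2.3) (`d_{x²−y²}`: `χ = χ_{B₁g}(γ)`).
[cite: Scalapino1995, §2 eq. (2.3)] -/
theorem relabel_d4Perm_localPair_of_parity (γ : DihedralGroup 4) (g : Site 2 → ℝ) (χ : ℝ)
    (hχ : χ * χ = 1) (hg : ∀ e, g (d4Vec γ e) = χ * g e) (x : TorusSite 2 L) :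
    relabel (Orb.d4Perm γ) (localPair g L x) = (χ : ℂ) • localPair g L (d4Site γ x) := by
  have hfun : g = (fun e => χ * g e) ∘ d4Vec γ := by
    funext e
    simp only [Function.comp_apply, hg e, ← mul_assoc, hχ, one_mul]
  conv_lhs => rw [hfun]
  rw [relabel_d4Perm_localPair, localPair_const_mul]

/-- **Hence the pair correlator is moved, not changed**: `U_γ (Δ_0† Δ_r) U_γᴴ = Δ_0† Δ_{γr}` (`|χ|² = 1`,
`γ 0 = 0`). Scalapino 1995 §2 eq. (2.3). [cite: Scalapino1995, §2 eq. (2.3)] -/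
theorem relabel_d4Perm_localPair_corr_of_parity (γ : DihedralGroup 4) (g : Site 2 → ℝ) (χ : ℝ)
    (hχ : χ * χ = 1) (hg : ∀ e, g (d4Vec γ e) = χ * g e) (r : TorusSite 2 L) :
    relabel (Orb.d4Perm γ) ((localPair g L 0)ᴴ * localPair g L r) =
      (localPair g L 0)ᴴ * localPair g L (d4Site γ r) := by
  rw [relabel_mul, relabel_conjTranspose, relabel_d4Perm_localPair_of_parity γ g χ hχ hg,
    relabel_d4Perm_localPair_of_parity γ g χ hχ hg, d4Site_zero, conjTranspose_smul, smul_mul_smul_comm,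
    Complex.star_def, Complex.conj_ofReal, ← Complex.ofReal_mul, hχ, Complex.ofReal_one, one_smul]

/-- **The space-group sum of the pair correlator is the orbit sum of translation sums**:
`Σ_{(w,γ) ∈ 𝕋_L × S} V_{(w,γ)} (Δ_0† Δ_r) V_{(w,γ)}ᴴ = Σ_{γ∈S} Σ_x Δ_x† Δ_{x+γr}`
(`V_{(w,γ)} = U_w U_γ`). Scalapino 1995 §2 eq. (2.3); Han 2020 §2 eq. (2) (space-group averaging).
[cite: Han2020Bootstrap, §2 eq. (2)] -/
theorem sum_spaceGroupUnitary_conj_localPair_corr (S : Finset (DihedralGroup 4)) (g : Site 2 → ℝ)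
    (χ : DihedralGroup 4 → ℝ) (hχ : ∀ γ ∈ S, χ γ * χ γ = 1)
    (hg : ∀ γ ∈ S, ∀ e, g (d4Vec γ e) = χ γ * g e) (r : TorusSite 2 L) :
    ∑ gg : TorusSite 2 L × ↥S,
        spaceGroupUnitary S gg * ((localPair g L 0)ᴴ * localPair g L r) * (spaceGroupUnitary S gg)ᴴ =
      ∑ γ ∈ S, ∑ x : TorusSite 2 L, (localPair g L x)ᴴ * localPair g L (x + d4Site γ r) := by
  rw [Fintype.sum_prod_type, Finset.sum_comm, ← Finset.sum_coe_sort S]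
  refine Finset.sum_congr rfl fun γ _ => ?_
  rw [← sum_conj_fockTranslate_localPair_corr]
  refine Finset.sum_congr rfl fun w _ => ?_
  have hγ : relabel (Orb.d4Perm (γ : DihedralGroup 4)) ((localPair g L 0)ᴴ * localPair g L r) =
      (localPair g L 0)ᴴ * localPair g L (d4Site (γ : DihedralGroup 4) r) :=
    relabel_d4Perm_localPair_corr_of_parity _ g (χ γ) (hχ γ γ.2) (hg γ γ.2) r
  rw [relabel_eq_fockRelabel_conj, ← fockD4_apply] at hγ
  show (fockTranslate w).val * (fockD4 (L := L) (γ : DihedralGroup 4)).val * ((localPair g L 0)ᴴ * localPair g L r) *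
      ((fockTranslate w).val * (fockD4 (L := L) (γ : DihedralGroup 4)).val)ᴴ = _
  rw [← hγ, conjTranspose_mul]
  simp only [Matrix.mul_assoc]

/-- **`⟨ψ, (Σ_{γ∈S} Σ_x Δ_x† Δ_{x+γr}) ψ⟩ = L² |S| · ω̄_ψ(Δ_0† Δ_r)`**, `ω̄_ψ` the `𝕋_L ⋊ S`-averaged vector
state `orbitState (spaceGroupUnitary S) ψ` (`S ∋ 1`). Han 2020 §2 eq. (2). [cite: Han2020Bootstrap, §2 eq. (2)] -/
theorem star_dotProduct_sum_pairCorrSum_mulVec_eq {S : Finset (DihedralGroup 4)}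
    (h1 : (1 : DihedralGroup 4) ∈ S) (g : Site 2 → ℝ) (χ : DihedralGroup 4 → ℝ)
    (hχ : ∀ γ ∈ S, χ γ * χ γ = 1) (hg : ∀ γ ∈ S, ∀ e, g (d4Vec γ e) = χ γ * g e) (r : TorusSite 2 L)
    (ψ : Fock (Orb (FermionTorus 2 L))) :
    star ψ ⬝ᵥ ((∑ γ ∈ S, ∑ x : TorusSite 2 L, (localPair g L x)ᴴ * localPair g L (x + d4Site γ r)) *ᵥ ψ) =
      ((L ^ 2 * S.card : ℕ) : ℂ) *
        orbitState (spaceGroupUnitary S) ψ ((localPair g L 0)ᴴ * localPair g L r) := by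
  rw [← sum_spaceGroupUnitary_conj_localPair_corr S g χ hχ hg, star_dotProduct_sum_spaceGroup_conj_mulVec h1]

/-- Real parts: `Re ω̄_ψ(Δ_0† Δ_r) = (Σ_{γ∈S} Re ⟨ψ, (Σ_x Δ_x† Δ_{x+γr}) ψ⟩) / (L² |S|)`.
[cite: Han2020Bootstrap, §2 eq. (2)] -/
theorem re_orbitState_localPair_corr_eq_sum_div {S : Finset (DihedralGroup 4)}
    (h1 : (1 : DihedralGroup 4) ∈ S) (g : Site 2 → ℝ) (χ : DihedralGroup 4 → ℝ)
    (hχ : ∀ γ ∈ S, χ γ * χ γ = 1) (hg : ∀ γ ∈ S, ∀ e, g (d4Vec γ e) = χ γ * g e) (r : TorusSite 2 L)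
    (ψ : Fock (Orb (FermionTorus 2 L))) :
    (orbitState (spaceGroupUnitary S) ψ ((localPair g L 0)ᴴ * localPair g L r)).re =
      (∑ γ ∈ S, (star ψ ⬝ᵥ ((∑ x : TorusSite 2 L, (localPair g L x)ᴴ * localPair g L (x + d4Site γ r)) *ᵥ ψ)).re) /
        ((L : ℝ) ^ 2 * S.card) := by
  have hLr : ((L : ℝ)) ^ 2 * S.card ≠ 0 :=
    mul_ne_zero (pow_ne_zero 2 (Nat.cast_ne_zero.2 (NeZero.ne L)))
      (Nat.cast_ne_zero.2 (Finset.card_ne_zero.2 ⟨1, h1⟩))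
  have h := star_dotProduct_sum_pairCorrSum_mulVec_eq h1 g χ hχ hg r ψ
  rw [Matrix.sum_mulVec, dotProduct_sum] at h
  rw [← Complex.re_sum, h]
  have hc : ((L ^ 2 * S.card : ℕ) : ℂ) = ((((L : ℝ)) ^ 2 * S.card : ℝ) : ℂ) := by push_cast; ring
  rw [hc, Complex.re_ofReal_mul, mul_div_cancel_left₀ _ hLr]

end Covariance

/-! ## The symmetric certificate bounds the orbit-averaged pair correlator of every ground state -/

section GroundState

variable {L : ℕ} [NeZero L]

/-- (Local to this section.) [folklore] -/
local instance (priority := high) instDecidableEqFermionTorusPairD4' : DecidableEq (FermionTorus 2 L) :=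
  LinearOrder.toDecidableEq

/-- **Symmetry-reduced window certificate ⇒ uniform-in-`L` bound on the orbit-averaged pair correlator
of EVERY sector ground state.** Data as in `re_orbitState_ge_of_window_certificate_d4_TT'_ineq`
(point group `S ∋ 1` closed under multiplication, translation/point-group defects with `γₗ ∈ S`,
`κ ≥ 0`), objective `windowPairCorrObs ({0} ∪ unitSteps) g r` for a form factor of definite `S`-parity
(`g(γe) = χ(γ) g(e)`, `χ(γ)² = 1` on `S`). Then for every `L ≥ 3` with `x ↦ x mod L` injective on
`thicken Λ' 1`, every `n ≤ |𝕋_L|` with `groundEnergy (hubbardTorusTT' L t t' U) (2n) / L² ≤ u` and every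
unit ground state `ψ` of the sector `(2n, S^z = 0)`:
`c − Σₖ ‖aₖ‖ + (Σ_σ μ_σ)(n/L² − ν) ≤ (Σ_{γ∈S} Re ⟨ψ, (Σ_x Δ_x† Δ_{x + γ r̄}) ψ⟩) / (L² |S|)`.
Wang et al. 2024 §III (symmetry-reduced energy-constrained RDM bootstrap) in Han's space-group form,
read on finite tori in the symmetrised state of an arbitrary ground-state vector. [cite: WangEtAl2024, §III] -/
theorem re_sum_pairCorrSum_groundState_ge_of_window_certificate_d4_TT' (t t' U : ℝ) (hL : 3 ≤ L)
    (g : Site 2 → ℝ) (χ : DihedralGroup 4 → ℝ) {S : Finset (DihedralGroup 4)}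
    (h1 : (1 : DihedralGroup 4) ∈ S) (hmul : ∀ a ∈ S, ∀ b ∈ S, a * b ∈ S)
    (hχ : ∀ γ ∈ S, χ γ * χ γ = 1) (hg : ∀ γ ∈ S, ∀ e, g (d4Vec γ e) = χ γ * g e)
    (r : Site 2) {nh : ℕ} (hn : nh ≤ Fintype.card (FermionTorus 2 L))
    {Λ Λ' : Finset (Site 2)} (hΛ : Λ ⊆ Λ') (h8 : thicken Λ 1 ⊆ Λ')
    (h0 : thicken ({0} : Finset (Site 2)) 1 ⊆ Λ') (hz : (0 : Site 2) ∈ Λ')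
    (hp0 : pairRegion (insert 0 unitSteps) 0 ⊆ Λ') (hpr : pairRegion (insert 0 unitSteps) r ⊆ Λ')
    (hInj : Set.InjOn (Torus.proj (d := 2) L) ↑(thicken Λ' 1))
    (hInj' : Set.InjOn (Torus.proj (d := 2) L) ↑Λ')
    {ψ : Fock (Orb (FermionTorus 2 L))}
    (hGS : IsGroundStateInSector (hubbardTorusTT' L t t' U) (2 * nh) 0 ψ) (hψ1 : star ψ ⬝ᵥ ψ = 1)
    {κ u : ℝ} (hκ : 0 ≤ κ) (hu : groundEnergy (hubbardTorusTT' L t t' U) (2 * nh) / (L : ℝ) ^ 2 ≤ u)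
    (μ : Fin 2 → ℝ) (ν : ℝ)
    {m : Type*} [Fintype m] [DecidableEq m] {Λm : Matrix m m ℂ} (hΛm : Λm.PosSemidef)
    (O : m → FermionOp Λ')
    {κ' : Type*} (s : Finset κ') (B : κ' → FermionOp Λ)
    {ι : Type*} (tt : Finset ι) (γ : ι → DihedralGroup 4) (hγS : ∀ l ∈ tt, γ l ∈ S) (wv : ι → Site 2)
    (hsh : ∀ l, d4ShiftSet (γ l) (wv l) Λ ⊆ Λ') (Y : ι → FermionOp Λ)
    {ρ : Type*} (uu : Finset ρ) (b : ρ → ℂ) (cw : ρ → List (Orb (PolySite Λ') × Bool))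
    (hcw : ∀ j ∈ uu, ladderCharge (cw j) ≠ 0 ∨ ladderSpinCharge (cw j) ≠ 0)
    {δ : Type*} (ah : Finset δ) (dc : δ → ℝ) (V : δ → FermionOp Λ')
    {κ'' : Type*} (w : Finset κ'') (a : κ'' → ℂ) (word : κ'' → List (Orb (PolySite Λ') × Bool)) {c : ℝ}
    (hcert : windowPairCorrObs (insert 0 unitSteps) g r hp0 hpr - (c : ℂ) • (1 : FermionOp Λ') -
        ∑ σ : Fin 2, ((μ σ : ℝ) : ℂ) • (nAt 0 hz σ - ((ν : ℝ) : ℂ) • (1 : FermionOp Λ')) -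
        ((κ : ℝ) : ℂ) • (((u : ℝ) : ℂ) • (1 : FermionOp Λ') -
          fermionEmbed (PolySite.incl h0) ((hubbardTTPrimeFermionInteraction t t' U).meanEnergyObs 1)) =
      gramForm Λm O +
        (∑ k ∈ s, ((hubbardTTPrimeFermionInteraction t t' U).localHamiltonian Λ' * fermionEmbed (PolySite.incl hΛ) (B k) -
            fermionEmbed (PolySite.incl hΛ) (B k) * (hubbardTTPrimeFermionInteraction t t' U).localHamiltonian Λ') +
          ∑ l ∈ tt, (fermionEmbed (PolySite.incl (hsh l)) (fermionEmbed (PolySite.d4Emb (γ l) (wv l) Λ) (Y l)) -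
            fermionEmbed (PolySite.incl hΛ) (Y l)) +
          ∑ j ∈ uu, b j • ladderWord (cw j)) +
        (∑ m' ∈ ah, ((dc m' : ℝ) : ℂ) • ((V m')ᴴ - V m') + ∑ k ∈ w, a k • ladderWord (word k))) :
    c - ∑ k ∈ w, ‖a k‖ + (∑ σ : Fin 2, μ σ) * ((nh : ℝ) / (L : ℝ) ^ 2 - ν) ≤
      (∑ γ' ∈ S, (star ψ ⬝ᵥ ((∑ x : TorusSite 2 L,
          (localPair g L x)ᴴ * localPair g L (x + d4Site γ' (Torus.proj L r))) *ᵥ ψ)).re) /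
        ((L : ℝ) ^ 2 * S.card) := by
  have h := re_orbitState_ge_of_window_certificate_d4_TT'_groundState t t' U hL hn hΛ h8 h0 hz hInj hInj'
    h1 hmul hGS hψ1 hκ hu (windowPairCorrObs (insert 0 unitSteps) g r hp0 hpr) μ ν hΛm O s B tt γ hγS wv
    hsh Y uu b cw hcw ah dc V w a word hcert
  rw [fermionEmbed_toTorusEmb_windowPairCorrObs_localPair,
    re_orbitState_localPair_corr_eq_sum_div h1 g χ hχ hg] at h
  exact h

/-- The `B₁g` sign of `γ ∈ D₄` as a real number (`+1` on `{1, r², s, s r²}`, `−1` on `{r, r³, s r, s r³}`):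
`g_d(γ e) = b1gSign γ · g_d(e)` (`dWaveFormFactor_d4Vec`). [cite: Scalapino1995, §2 eq. (2.3)] -/
def b1gSign : DihedralGroup 4 → ℝ
  | DihedralGroup.r i => (-1 : ℝ) ^ i.val
  | DihedralGroup.sr i => (-1 : ℝ) ^ i.val

/-- `b1gSign γ` is a sign. [cite: Scalapino1995, §2 eq. (2.3)] -/
theorem b1gSign_mul_self (γ : DihedralGroup 4) : b1gSign γ * b1gSign γ = 1 := by
  cases γ <;> (simp only [b1gSign, ← pow_add, ← two_mul]; rw [pow_mul]; norm_num)

/-- `g_d (γ e) = b1gSign γ · g_d e` (the `d_{x²−y²}` form factor spans `B₁g`). [cite: Scalapino1995, §2 eq. (2.3)] -/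
theorem dWaveFormFactor_d4Vec_eq_b1gSign_mul (γ : DihedralGroup 4) (e : Site 2) :
    dWaveFormFactor (d4Vec γ e) = b1gSign γ * dWaveFormFactor e := by
  rw [dWaveFormFactor_d4Vec]
  cases γ <;> rfl

/-- **The `d_{x²−y²}` case, any point group `S ∋ 1` closed under multiplication (e.g. `S = D₄`)**: the
`S`-reduced window certificate for `P_0† P_r` (d-wave) bounds
`(L² |S|)⁻¹ Σ_{γ∈S} Re ⟨ψ, (Σ_x Δ_x† Δ_{x+γr̄}) ψ⟩` from below by `c − Σₖ ‖aₖ‖ + (Σ_σ μ_σ)(n/L² − ν)` for every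
unit ground state `ψ` of the sector `(2n, 0)` of every torus the window fits, whenever
`groundEnergy (hubbardTorusTT' L t t' U) (2n) / L² ≤ u`. Scalapino 1995 §2; Wang et al. 2024 §III.
[cite: WangEtAl2024, §III] -/
theorem re_sum_pairCorrSum_groundState_ge_of_window_certificate_d4_TT'_dWave (t t' U : ℝ) (hL : 3 ≤ L)
    {S : Finset (DihedralGroup 4)} (h1 : (1 : DihedralGroup 4) ∈ S) (hmul : ∀ a ∈ S, ∀ b ∈ S, a * b ∈ S)
    (r : Site 2) {nh : ℕ} (hn : nh ≤ Fintype.card (FermionTorus 2 L))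
    {Λ Λ' : Finset (Site 2)} (hΛ : Λ ⊆ Λ') (h8 : thicken Λ 1 ⊆ Λ')
    (h0 : thicken ({0} : Finset (Site 2)) 1 ⊆ Λ') (hz : (0 : Site 2) ∈ Λ')
    (hp0 : pairRegion (insert 0 unitSteps) 0 ⊆ Λ')
    (hpr : pairRegion (insert 0 unitSteps) r ⊆ Λ')
    (hInj : Set.InjOn (Torus.proj (d := 2) L) ↑(thicken Λ' 1))
    (hInj' : Set.InjOn (Torus.proj (d := 2) L) ↑Λ')
    {ψ : Fock (Orb (FermionTorus 2 L))}
    (hGS : IsGroundStateInSector (hubbardTorusTT' L t t' U) (2 * nh) 0 ψ) (hψ1 : star ψ ⬝ᵥ ψ = 1)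
    {κ u : ℝ} (hκ : 0 ≤ κ) (hu : groundEnergy (hubbardTorusTT' L t t' U) (2 * nh) / (L : ℝ) ^ 2 ≤ u)
    (μ : Fin 2 → ℝ) (ν : ℝ)
    {m : Type*} [Fintype m] [DecidableEq m] {Λm : Matrix m m ℂ} (hΛm : Λm.PosSemidef)
    (O : m → FermionOp Λ')
    {κ' : Type*} (s : Finset κ') (B : κ' → FermionOp Λ)
    {ι : Type*} (tt : Finset ι) (γ : ι → DihedralGroup 4) (hγS : ∀ l ∈ tt, γ l ∈ S) (wv : ι → Site 2)
    (hsh : ∀ l, d4ShiftSet (γ l) (wv l) Λ ⊆ Λ') (Y : ι → FermionOp Λ)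
    {ρ : Type*} (uu : Finset ρ) (b : ρ → ℂ) (cw : ρ → List (Orb (PolySite Λ') × Bool))
    (hcw : ∀ j ∈ uu, ladderCharge (cw j) ≠ 0 ∨ ladderSpinCharge (cw j) ≠ 0)
    {δ : Type*} (ah : Finset δ) (dc : δ → ℝ) (V : δ → FermionOp Λ')
    {κ'' : Type*} (w : Finset κ'') (a : κ'' → ℂ) (word : κ'' → List (Orb (PolySite Λ') × Bool)) {c : ℝ}
    (hcert : windowPairCorrObs (insert 0 unitSteps) dWaveFormFactor r hp0 hpr - (c : ℂ) • (1 : FermionOp Λ') -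
        ∑ σ : Fin 2, ((μ σ : ℝ) : ℂ) • (nAt 0 hz σ - ((ν : ℝ) : ℂ) • (1 : FermionOp Λ')) -
        ((κ : ℝ) : ℂ) • (((u : ℝ) : ℂ) • (1 : FermionOp Λ') -
          fermionEmbed (PolySite.incl h0) ((hubbardTTPrimeFermionInteraction t t' U).meanEnergyObs 1)) =
      gramForm Λm O +
        (∑ k ∈ s, ((hubbardTTPrimeFermionInteraction t t' U).localHamiltonian Λ' * fermionEmbed (PolySite.incl hΛ) (B k) -
            fermionEmbed (PolySite.incl hΛ) (B k) * (hubbardTTPrimeFermionInteraction t t' U).localHamiltonian Λ') +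
          ∑ l ∈ tt, (fermionEmbed (PolySite.incl (hsh l)) (fermionEmbed (PolySite.d4Emb (γ l) (wv l) Λ) (Y l)) -
            fermionEmbed (PolySite.incl hΛ) (Y l)) +
          ∑ j ∈ uu, b j • ladderWord (cw j)) +
        (∑ m' ∈ ah, ((dc m' : ℝ) : ℂ) • ((V m')ᴴ - V m') + ∑ k ∈ w, a k • ladderWord (word k))) :
    c - ∑ k ∈ w, ‖a k‖ + (∑ σ : Fin 2, μ σ) * ((nh : ℝ) / (L : ℝ) ^ 2 - ν) ≤
      (∑ γ' ∈ S, (star ψ ⬝ᵥ ((∑ x : TorusSite 2 L,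
          (localPair dWaveFormFactor L x)ᴴ * localPair dWaveFormFactor L (x + d4Site γ' (Torus.proj L r))) *ᵥ ψ)).re) /
        ((L : ℝ) ^ 2 * S.card) :=
  re_sum_pairCorrSum_groundState_ge_of_window_certificate_d4_TT' t t' U hL dWaveFormFactor b1gSign h1 hmul
    (fun γ _ => b1gSign_mul_self γ) (fun γ _ e => dWaveFormFactor_d4Vec_eq_b1gSign_mul γ e) r hn hΛ h8 h0 hz
    hp0 hpr hInj hInj' hGS hψ1 hκ hu μ ν hΛm O s B tt γ hγS wv hsh Y uu b cw hcw ah dc V w a word hcert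

end GroundState

end Literature.MathematicalPhysics.QuantumLattice

end
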